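import Summits.FinalStateConjecture.FinalStateConjecture.Theses.LapseTrumpetKID
import HarnessLib

/-!
# Birth skeleton — crux stmt-FinalStateConjecture-10160 `Theses.LapseTrumpetKID.TrappedWellsSubextremal`
# (route-FinalStateConjecture-LapseTrumpetKID, rank 4: THE THIRD LAW IN SLICE FORM), line `birth`
# (skeleton registrar planner-skel-stmt-FinalStateConjecture-10160-0, 2026-08-17; BC3 of
# run/shared/lean/lens3/_common/BC.md)

The crux (deterministic, every admissible datum `D`): for every MGHD `𝒟` with complete `𝓘⁺`, every
NORMALISED MAXIMAL CAUCHY FOLIATION `(F, ν)` of `𝒟` (clause (ii) of `MaximalCensorship`: `F : ℝ × X → 𝒟.carrier`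
smooth, every `x ↦ F (t, x)` a smooth embedding onto a Cauchy hypersurface with future unit normal `ν t`, induced
data maximal, complete, AF of order 1 at a sole end, lapse `N(t,x) = −g(∂ₜF, ν) > 0`, `N(t,·) → 1` cocompactly for
`t ≥ 0`) whose WELLS ARE TRAPPED (clause (iii): `∃ ε > 0, t₀` such that `t ≥ t₀`, `N(t,x) < ε`, `t' ≥ t`,
`N(t',x') > 1 − ε` ⇒ `F(t',x') ∉ J⁺(F(t,x))`), and EVERY honest exhaustive `2`-decomposition `d` of
`O = exteriorOf 𝒟 d.charted` (`HasExhaustiveCharts d`): every final hole is sub-extremal,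
`Kerr.IsSubextremal (d.mass i) (d.spin i)`.

THE CUT (the route's own one-sentence mechanism, "an extremal remnant would carry a lapse well down its throat
OUTSIDE the horizon, i.e. an untrapped well", typed as two lemmas meeting at the exterior region `O`; neither uses
the trapped-wells clause (iii), which is consumed only by the composition):

* `stub_extremalHoleDigsExteriorWell` (E, the THROAT LEMMA, hardest): under the foliation clauses (ii) alone, if
  some hole `i` of an honest exhaustive decomposition `d` is EXTREMAL (`Kerr.IsExtremal (d.mass i) (d.spin i)`,
  i.e. `|aᵢ| = Mᵢ > 0` — the only alternative to sub-extremality, since `|aᵢ| ≤ Mᵢ`, `0 < Mᵢ` are fields of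
  `FinalStateDecomposition`), then for every `ε > 0` and every `t₀` some leaf `t ≥ t₀` carries a point `F(t,x) ∈ O`
  with lapse `N(t,x) < ε`: the extremal throat `{Mᵢ < rᵢ < Mᵢ + δ}` (inside hole `i`'s exterior chart image, hence
  inside `O`) is an arbitrarily deep lapse well of the late maximal leaves — the slice-level signature of vanishing
  surface gravity (static calibration: on the maximal `t = const` slices of extremal Reissner–Nordström
  `N = 1 − M/r → 0` as `r ↓ M = r₊`, every such point in the d.o.c.; Beig–Ó Murchadha's limit cylinder
  `r_c = (3M + √(9M² − 8Q²))/4 ↓ r₊` as `Q ↑ M`).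
* `stub_exteriorWellsReachFarZone` (U, the ESCAPE LEMMA): under the foliation clauses (ii) alone, every foliation
  point of the exterior region, `F(t,x) ∈ O = J⁺(ιX) ∩ I⁻(d.charted)`, causally reaches, on some later leaf
  `t' ≥ t`, a point `F(t',x')` with lapse `N(t',x') > 1 − ε`: exterior events signal to the asymptotic zone where the
  maximal lapse has recovered (content: monotonicity of the leaves from `N > 0`; `O ⊆ I⁻(charted)` and
  `HasExhaustiveCharts` push any exterior event into the past of certified late slabs, whence outgoing curves reach
  arbitrarily large chart radii; and the lapse deficit `1 − N` of the maximal leaves decays in the far zone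
  UNIFORMLY along the foliation — per leaf it is only `N(t,·) → 1` cocompactly —, so that the compact set
  `J⁺(F(t,x)) ∩ Σ_{t'}`, which grows with `t'`, eventually leaves `{N(t',·) ≤ 1 − ε}`).

Composition `TrappedWellsSubextremal_of : Sig.E → Sig.U → TrappedWellsSubextremal` (real proof, no `sorry`): a
hole that is not sub-extremal is extremal (`abs_spin_le_mass`, `mass_pos`); E produces a late exterior `ε`-well
`F(t,x)`, `t ≥ t₀`, for the thresholds `(ε, t₀)` of clause (iii); U lets it signal to a later far-zone point
`F(t',x')`, `N > 1 − ε`; clause (iii) says it cannot — contradiction. `trappedWellsSubextremal_of_stubs` then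
proves the route item BY NAME modulo the two stubs.

Foreseen split of E (not filed; two layers max): E ⇐ (E1, near-throat lapse bound: a complete maximal AF Cauchy
leaf whose image crosses a region `C²`-close to the extremal Kerr–Schild throat `{M < r < M + δ}` has foliation
lapse `< ε(δ)` there, `ε(δ) → 0` — elliptic/Harnack estimate for `Δ_h N = |k|² N` against the degenerate horizon)
+ (E2, late leaves do cross the certified throat region of an extremal hole, or else pile up inside `O` with
`N → 0` there). Disproof used: none exists for this crux at registration (`ledger crux ls`: no workfiles; negatives
index of the summit: no entry bearing on lapse wells). Dead lines: none recorded.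
-/

set_option linter.dupNamespace false

noncomputable section

open scoped Manifold ContDiff Topology
open Filter Set Function Literature.Geometry.Lorentzian

namespace Summit.FinalStateConjecture.FinalStateConjecture.Cruxes.TrappedWellsSubextremal.Birth

open Summit.FinalStateConjecture.FinalStateConjecture.Theses.LapseTrumpetKID (TrappedWellsSubextremal)

/-! ## Legend: the two stub statements as named propositions (verbatim the registered signatures) -/

/-- Statement of `stub_extremalHoleDigsExteriorWell` (E): under the normalised-maximal-foliation clauses, an
EXTREMAL hole of an honest exhaustive decomposition forces, for every `ε > 0` and every `t₀`, a foliation point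
`F(t,x) ∈ O` with `t ≥ t₀` and lapse `< ε`. -/
def Sig.stub_extremalHoleDigsExteriorWell : Prop :=
  open Literature.Geometry.Lorentzian in ∀ (X : Type) [TopologicalSpace X] [ChartedSpace E3 X] [IsManifold (𝓡 3) (⊤ : ℕ∞) X] [T2Space X] [SecondCountableTopology X] [ConnectedSpace X] (D : InitialDataSet (𝓡 3) X), D ∈ admissibleVacuumData X → ∀ 𝒟 : VacuumCauchyDevelopment D, 𝒟.IsMaximal → Summit.FinalStateConjecture.HasCompleteNullInfinity 𝒟.toCauchyDevelopment → ∀ (F : ℝ × X → 𝒟.carrier) (ν : ∀ t : ℝ, NormalField (𝓡 4) (fun x : X ↦ F (t, x))), (ContMDiff (𝓘(ℝ, ℝ).prod (𝓡 3)) (𝓡 4) (⊤ : ℕ∞) F ∧ (∀ t, Manifold.IsSmoothEmbedding (𝓡 3) (𝓡 4) (⊤ : ℕ∞) (fun x ↦ F (t, x))) ∧ (∀ t, 𝒟.metric.IsCauchyHypersurface 𝒟.timeOrientation (range fun x ↦ F (t, x))) ∧ (∀ t, 𝒟.metric.IsFutureUnitNormal (𝓡 3) 𝒟.timeOrientation (fun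 x ↦ F (t, x)) (ν t)) ∧ (∀ t, ∃ Dt : InitialDataSet (𝓡 3) X, (∀ (x : X) (v w : TangentSpace (𝓡 3) x), Dt.h.inner x v w = 𝒟.metric.val (F (t, x)) (mfderiv (𝓡 3) (𝓡 4) (fun y ↦ F (t, y)) x v) (mfderiv (𝓡 3) (𝓡 4) (fun y ↦ F (t, y)) x w)) ∧ (∀ [𝒟.metric.toPseudoRiemannianMetric.HasLeviCivita] (x : X), 𝒟.metric.toPseudoRiemannianMetric.secondFundamentalForm (𝓡 3) (fun y ↦ F (t, y)) (ν t) x = Dt.kBilin x) ∧ Dt.IsMaximalData ∧ (∀ [Dt.metric.HasLeviCivita], Dt.IsComplete) ∧ ∃ e : AFEnd X, e.IsSoleEnd ∧ e.IsAsymptoticallyFlat Dt 1) ∧ (∀ t x, 0 < - 𝒟.metric.val (F (t, x)) (mfderiv 𝓘(ℝ, ℝ) (𝓡 4) (fun s : ℝ ↦ F (s, x)) t 1) (ν t x)) ∧ (∀ t, 0 ≤ t → Tendsto (fun x ↦ - 𝒟.metric.val (F (t, x)) (mfderiv 𝓘(ℝ, ℝ) (𝓡 4) (fun s : ℝ ↦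 F (s, x)) t 1) (ν t x)) (cocompact X) (𝓝 1))) → ∀ (O : Set 𝒟.carrier) (d : FinalStateDecomposition 𝒟.toSpacetime O 2), O = Summit.FinalStateConjecture.exteriorOf 𝒟.toCauchyDevelopment d.charted → Summit.FinalStateConjecture.HasExhaustiveCharts d → ∀ i, Kerr.IsExtremal (d.mass i) (d.spin i) → ∀ ε : ℝ, 0 < ε → ∀ t₀ : ℝ, ∃ (t : ℝ) (x : X), t₀ ≤ t ∧ - 𝒟.metric.val (F (t, x)) (mfderiv 𝓘(ℝ, ℝ) (𝓡 4) (fun s : ℝ ↦ F (s, x)) t 1) (ν t x) < ε ∧ F (t, x) ∈ O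

/-- Statement of `stub_exteriorWellsReachFarZone` (U): under the normalised-maximal-foliation clauses, every
foliation point of `O` causally reaches a point of lapse `> 1 − ε` on some later leaf. -/
def Sig.stub_exteriorWellsReachFarZone : Prop :=
  open Literature.Geometry.Lorentzian in ∀ (X : Type) [TopologicalSpace X] [ChartedSpace E3 X] [IsManifold (𝓡 3) (⊤ : ℕ∞) X] [T2Space X] [SecondCountableTopology X] [ConnectedSpace X] (D : InitialDataSet (𝓡 3) X), D ∈ admissibleVacuumData X → ∀ 𝒟 : VacuumCauchyDevelopment D, 𝒟.IsMaximal → Summit.FinalStateConjecture.HasCompleteNullInfinity 𝒟.toCauchyDevelopment → ∀ (F : ℝ × X → 𝒟.carrier) (ν : ∀ t : ℝ, NormalField (𝓡 4) (fun x : X ↦ F (t, x))), (ContMDiff (𝓘(ℝ, ℝ).prod (𝓡 3)) (𝓡 4) (⊤ : ℕ∞) F ∧ (∀ t, Manifold.IsSmoothEmbedding (𝓡 3) (𝓡 4) (⊤ : ℕ∞) (fun x ↦ F (t, x))) ∧ (∀ t, 𝒟.metric.IsCauchyHypersurface 𝒟.timeOrientation (range fun x ↦ F (t, x))) ∧ (∀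 t, 𝒟.metric.IsFutureUnitNormal (𝓡 3) 𝒟.timeOrientation (fun x ↦ F (t, x)) (ν t)) ∧ (∀ t, ∃ Dt : InitialDataSet (𝓡 3) X, (∀ (x : X) (v w : TangentSpace (𝓡 3) x), Dt.h.inner x v w = 𝒟.metric.val (F (t, x)) (mfderiv (𝓡 3) (𝓡 4) (fun y ↦ F (t, y)) x v) (mfderiv (𝓡 3) (𝓡 4) (fun y ↦ F (t, y)) x w)) ∧ (∀ [𝒟.metric.toPseudoRiemannianMetric.HasLeviCivita] (x : X), 𝒟.metric.toPseudoRiemannianMetric.secondFundamentalForm (𝓡 3) (fun y ↦ F (t, y)) (ν t) x = Dt.kBilin x) ∧ Dt.IsMaximalData ∧ (∀ [Dt.metric.HasLeviCivita], Dt.IsComplete) ∧ ∃ e : AFEnd X, e.IsSoleEnd ∧ e.IsAsymptoticallyFlat Dt 1) ∧ (∀ t x, 0 < - 𝒟.metric.val (F (t, x)) (mfderiv 𝓘(ℝ, ℝ) (𝓡 4) (fun s : ℝ ↦ F (s, x)) t 1) (ν t x)) ∧ (∀ t, 0 ≤ t → Tendsto (fun x ↦ - 𝒟.metric.val (F (t,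 x)) (mfderiv 𝓘(ℝ, ℝ) (𝓡 4) (fun s : ℝ ↦ F (s, x)) t 1) (ν t x)) (cocompact X) (𝓝 1))) → ∀ (O : Set 𝒟.carrier) (d : FinalStateDecomposition 𝒟.toSpacetime O 2), O = Summit.FinalStateConjecture.exteriorOf 𝒟.toCauchyDevelopment d.charted → Summit.FinalStateConjecture.HasExhaustiveCharts d → ∀ ε : ℝ, 0 < ε → ∀ (t : ℝ) (x : X), F (t, x) ∈ O → ∃ (t' : ℝ) (x' : X), t ≤ t' ∧ 1 - ε < - 𝒟.metric.val (F (t', x')) (mfderiv 𝓘(ℝ, ℝ) (𝓡 4) (fun s : ℝ ↦ F (s, x')) t' 1) (ν t' x') ∧ F (t', x') ∈ 𝒟.metric.causalFuture 𝒟.timeOrientation {F (t, x)}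

/-! ## Registered stubs (`sorry` only here; signatures def-free over tree declarations) -/

/-- **E — AN EXTREMAL FINAL HOLE DIGS A LAPSE WELL OUTSIDE ITS HORIZON** (the throat lemma; hardest stub, L–XL).
For every admissible datum `D`, every MGHD `𝒟` with complete `𝓘⁺`, every normalised maximal Cauchy foliation
`(F, ν)` (clause (ii) of `MaximalCensorship` verbatim — NOT the trapped-wells clause) and every honest exhaustive
decomposition `d` of `O = exteriorOf 𝒟 d.charted`: if hole `i` is extremal, `Kerr.IsExtremal (d.mass i) (d.spin i)`,
then `∀ ε > 0, ∀ t₀, ∃ t ≥ t₀, ∃ x, N(t,x) < ε ∧ F(t,x) ∈ O`. Plausible because the near zone of hole `i`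
`C²`-converges, on slabs reaching down to `r₊ = Mᵢ` (honest radii), to the extremal Kerr exterior, whose throat is
an infinite cylinder of vanishing red-shift: a complete maximal slice entering it has lapse `→ 0` along the throat
while staying in the domain of outer communications (extremal RN: `N = 1 − M/r` on the static maximal slices;
extremal Kerr: the `t = const` slices are maximal with `N² = Δ Σ / A → 0` at `r = M`), and late leaves of a Cauchy
foliation must either sweep the chart image of the throat or accumulate inside `O` (then `N → 0` there as well).
Why it might fail: unproved even for maximal foliations of exact extremal Kerr/RN developments (the leaves might
avoid the deep throat for all `t`, advancing there so slowly that `N` stays above a floor tied to `ε`-independent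
geometry — the pile-up locus and the exterior lapse floor are open, cf. the crux's why-line); near-horizon
near-extremal transients (Kehle–Unger extremal formation in finite time, arXiv:2211.15742; Aretakis instability
along the degenerate horizon) must be converted into a statement about the foliation's lapse, not the Killing lapse.
Sources: arXiv:2211.15742, doi:10.1103/PhysRevD.57.4728 (§IV, limit cylinder), doi:10.1103/PhysRevD.7.2814,
arXiv:gr-qc/0701037, arXiv:1710.01722, Literature.Barriers.FinalStateConjecture.AretakisInstability. -/
theorem stub_extremalHoleDigsExteriorWell : open Literature.Geometry.Lorentzian in ∀ (X : Type) [TopologicalSpace X] [ChartedSpace E3 X] [IsManifold (𝓡 3) (⊤ : ℕ∞) X] [T2Space X] [SecondCountableTopology X] [ConnectedSpace X] (D : InitialDataSet (𝓡 3) X), D ∈ admissibleVacuumData X → ∀ 𝒟 : VacuumCauchyDevelopment D, 𝒟.IsMaximal → Summit.FinalStateConjecture.HasCompleteNullInfinity 𝒟.toCauchyDevelopment → ∀ (F : ℝ × X → 𝒟.carrier) (ν : ∀ t : ℝ, NormalField (𝓡 4) (fun x : X ↦ F (t, x))), (ContMDiff (𝓘(ℝ, ℝ).prod (𝓡 3))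 (𝓡 4) (⊤ : ℕ∞) F ∧ (∀ t, Manifold.IsSmoothEmbedding (𝓡 3) (𝓡 4) (⊤ : ℕ∞) (fun x ↦ F (t, x))) ∧ (∀ t, 𝒟.metric.IsCauchyHypersurface 𝒟.timeOrientation (range fun x ↦ F (t, x))) ∧ (∀ t, 𝒟.metric.IsFutureUnitNormal (𝓡 3) 𝒟.timeOrientation (fun x ↦ F (t, x)) (ν t)) ∧ (∀ t, ∃ Dt : InitialDataSet (𝓡 3) X, (∀ (x : X) (v w : TangentSpace (𝓡 3) x), Dt.h.inner x v w = 𝒟.metric.val (F (t, x)) (mfderiv (𝓡 3) (𝓡 4) (fun y ↦ F (t, y)) x v) (mfderiv (𝓡 3) (𝓡 4) (fun y ↦ F (t, y)) x w)) ∧ (∀ [𝒟.metric.toPseudoRiemannianMetric.HasLeviCivita] (x : X), 𝒟.metric.toPseudoRiemannianMetric.secondFundamentalForm (𝓡 3) (fun y ↦ F (t, y)) (ν t) x = Dt.kBilin x) ∧ Dt.IsMaximalData ∧ (∀ [Dt.metric.HasLeviCivita], Dt.IsComplete) ∧ ∃ e : AFEnd X, e.IsSoleEnd ∧ e.IsAsymptoticallyFlat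 Dt 1) ∧ (∀ t x, 0 < - 𝒟.metric.val (F (t, x)) (mfderiv 𝓘(ℝ, ℝ) (𝓡 4) (fun s : ℝ ↦ F (s, x)) t 1) (ν t x)) ∧ (∀ t, 0 ≤ t → Tendsto (fun x ↦ - 𝒟.metric.val (F (t, x)) (mfderiv 𝓘(ℝ, ℝ) (𝓡 4) (fun s : ℝ ↦ F (s, x)) t 1) (ν t x)) (cocompact X) (𝓝 1))) → ∀ (O : Set 𝒟.carrier) (d : FinalStateDecomposition 𝒟.toSpacetime O 2), O = Summit.FinalStateConjecture.exteriorOf 𝒟.toCauchyDevelopment d.charted → Summit.FinalStateConjecture.HasExhaustiveCharts d → ∀ i, Kerr.IsExtremal (d.mass i) (d.spin i) → ∀ ε : ℝ, 0 < ε → ∀ t₀ : ℝ, ∃ (t : ℝ) (x : X), t₀ ≤ t ∧ - 𝒟.metric.val (F (t, x)) (mfderiv 𝓘(ℝ, ℝ) (𝓡 4) (fun s : ℝ ↦ F (s, x)) t 1) (ν t x) < ε ∧ F (t, x) ∈ O := by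
  sorry

/-- **U — EXTERIOR LAPSE WELLS ARE UNTRAPPED: EXTERIOR EVENTS SIGNAL TO THE FAR ZONE OF A LATER LEAF** (the escape
lemma, M–L). For every admissible datum `D`, every MGHD `𝒟` with complete `𝓘⁺`, every normalised maximal Cauchy
foliation `(F, ν)` (clause (ii) verbatim) and every honest exhaustive decomposition `d` of
`O = exteriorOf 𝒟 d.charted = J⁺(ιX) ∩ I⁻(d.charted)`: for every `ε > 0` and every foliation point `F(t,x) ∈ O`
there are `t' ≥ t` and `x'` with `N(t',x') > 1 − ε` and `F(t',x') ∈ J⁺(F(t,x))`. Plausible because (a) `N > 0`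
makes the Cauchy leaves strictly monotone (`Σ_{t'} ⊆ I⁺(Σ_t)` for `t' > t`), so `J⁺(p) ∩ Σ_{t'} ≠ ∅` for all
later leaves; (b) `p ∈ I⁻(d.charted)` and exhaustion (`O ∖ certifiedLate τ₁ ⊆ J⁻(certifiedSlab τ₁)` for all `τ₁`)
put certified points of arbitrarily late chart time into `J⁺(p)`, and from a certified near-zone or flat-zone point
(`C²`-close to Kerr–Schild / Minkowski on growing slabs) outgoing causal curves reach arbitrarily large radii;
(c) in the far zone the maximal lapse recovers, `1 − N = O(M/r)`, uniformly along the foliation, so the growing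
compact sets `J⁺(p) ∩ Σ_{t'}` eventually leave `{N(t',·) ≤ 1 − ε}`. Why it might fail: (c) is NOT in the
hypotheses — per leaf only `N(t,·) → 1` cocompactly, with a `t`-dependent compact set that could outrun
`J⁺(p) ∩ Σ_{t'}` if the leaves boost or the wells widen without bound; (b) needs chart time to agree with the
`g`-future, which the crux's decompositions carry only through `HasExhaustiveCharts` (no `IsFutureOriented d`,
no `RaysStayInClosure` among the crux hypotheses). Sources: doi:10.1007/bf01209300 (Bartnik, maximal surfaces,
Thm 4.1), doi:10.1103/PhysRevD.57.4728, ChristodoulouKlainerman1993 (maximal foliation, lapse asymptotics),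
ONeill1983 Ch. 14 (Cauchy hypersurfaces, `J⁺(p) ∩ Σ` compact), arXiv:1710.01722. -/
theorem stub_exteriorWellsReachFarZone : open Literature.Geometry.Lorentzian in ∀ (X : Type) [TopologicalSpace X] [ChartedSpace E3 X] [IsManifold (𝓡 3) (⊤ : ℕ∞) X] [T2Space X] [SecondCountableTopology X] [ConnectedSpace X] (D : InitialDataSet (𝓡 3) X), D ∈ admissibleVacuumData X → ∀ 𝒟 : VacuumCauchyDevelopment D, 𝒟.IsMaximal → Summit.FinalStateConjecture.HasCompleteNullInfinity 𝒟.toCauchyDevelopment → ∀ (F : ℝ × X → 𝒟.carrier) (ν : ∀ t : ℝ, NormalField (𝓡 4) (fun x : X ↦ F (t, x))), (ContMDiff (𝓘(ℝ, ℝ).prod (𝓡 3)) (𝓡 4) (⊤ : ℕ∞) F ∧ (∀ t, Manifold.IsSmoothEmbedding (𝓡 3) (𝓡 4) (⊤ : ℕ∞) (fun x ↦ F (t, x))) ∧ (∀ t, 𝒟.metric.IsCauchyHypersurface 𝒟.timeOrientation (range fun x ↦ F (t, x))) ∧ (∀ t, 𝒟.metric.IsFutureUnitNormal (𝓡 3)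 𝒟.timeOrientation (fun x ↦ F (t, x)) (ν t)) ∧ (∀ t, ∃ Dt : InitialDataSet (𝓡 3) X, (∀ (x : X) (v w : TangentSpace (𝓡 3) x), Dt.h.inner x v w = 𝒟.metric.val (F (t, x)) (mfderiv (𝓡 3) (𝓡 4) (fun y ↦ F (t, y)) x v) (mfderiv (𝓡 3) (𝓡 4) (fun y ↦ F (t, y)) x w)) ∧ (∀ [𝒟.metric.toPseudoRiemannianMetric.HasLeviCivita] (x : X), 𝒟.metric.toPseudoRiemannianMetric.secondFundamentalForm (𝓡 3) (fun y ↦ F (t, y)) (ν t) x = Dt.kBilin x) ∧ Dt.IsMaximalData ∧ (∀ [Dt.metric.HasLeviCivita], Dt.IsComplete) ∧ ∃ e : AFEnd X, e.IsSoleEnd ∧ e.IsAsymptoticallyFlat Dt 1) ∧ (∀ t x, 0 < - 𝒟.metric.val (F (t, x)) (mfderiv 𝓘(ℝ, ℝ) (𝓡 4) (fun s : ℝ ↦ F (s, x)) t 1) (ν t x)) ∧ (∀ t, 0 ≤ t → Tendsto (fun x ↦ - 𝒟.metric.val (F (t, x)) (mfderiv 𝓘(ℝ, ℝ) (𝓡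 4) (fun s : ℝ ↦ F (s, x)) t 1) (ν t x)) (cocompact X) (𝓝 1))) → ∀ (O : Set 𝒟.carrier) (d : FinalStateDecomposition 𝒟.toSpacetime O 2), O = Summit.FinalStateConjecture.exteriorOf 𝒟.toCauchyDevelopment d.charted → Summit.FinalStateConjecture.HasExhaustiveCharts d → ∀ ε : ℝ, 0 < ε → ∀ (t : ℝ) (x : X), F (t, x) ∈ O → ∃ (t' : ℝ) (x' : X), t ≤ t' ∧ 1 - ε < - 𝒟.metric.val (F (t', x')) (mfderiv 𝓘(ℝ, ℝ) (𝓡 4) (fun s : ℝ ↦ F (s, x')) t' 1) (ν t' x') ∧ F (t', x') ∈ 𝒟.metric.causalFuture 𝒟.timeOrientation {F (t, x)} := by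
  sorry

/-! ## Composition: the crux BY NAME from the two stubs (real proof, no `sorry`) -/

/-- **The third law in slice form from E and U.** Fix the data of the crux and a hole `i`. If `i` is not
sub-extremal then, by the structure fields `|aᵢ| ≤ Mᵢ` and `0 < Mᵢ`, it is extremal; with the thresholds
`(ε, t₀)` of the trapped-wells clause, E yields a leaf `t ≥ t₀` and a point `F(t,x) ∈ O` of lapse `< ε`; U
yields `t' ≥ t`, `x'` with lapse `> 1 − ε` and `F(t',x') ∈ J⁺(F(t,x))`; the trapped-wells clause forbids
exactly this. -/
theorem TrappedWellsSubextremal_of :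
    Sig.stub_extremalHoleDigsExteriorWell → Sig.stub_exteriorWellsReachFarZone →
      Summit.FinalStateConjecture.FinalStateConjecture.Theses.LapseTrumpetKID.TrappedWellsSubextremal := by
  intro hE hU X _ _ _ _ _ _ D hD 𝒟 hmax hscri F ν hMF hWT O d hO hexh i
  -- a final hole is either sub-extremal or extremal
  by_contra hsub
  have hle : d.mass i ≤ |d.spin i| := by
    unfold Kerr.IsSubextremal at hsub
    exact not_lt.mp hsub
  have hext : Kerr.IsExtremal (d.mass i) (d.spin i) :=
    ⟨le_antisymm (d.abs_spin_le_mass i) hle, d.mass_pos i⟩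
  -- the thresholds of the trapped-wells clause (iii)
  obtain ⟨ε, hε, t₀, hW⟩ := hWT
  -- E: the extremal throat of hole `i` is an `ε`-well of some leaf `t ≥ t₀`, inside `O`
  obtain ⟨t, x, ht, hNx, hxO⟩ := hE X D hD 𝒟 hmax hscri F ν hMF O d hO hexh i hext ε hε t₀
  -- U: that exterior well signals to the far zone (`N > 1 - ε`) of a later leaf
  obtain ⟨t', x', htt', hNx', hJ⟩ := hU X D hD 𝒟 hmax hscri F ν hMF O d hO hexh ε hε t x hxO
  -- clause (iii): wells that deep, that late, cannot signal there
  exact hW t x ht hNx t' x' htt' hNx' hJ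

/-- The crux by name, closed modulo the two registered stubs. -/
theorem trappedWellsSubextremal_of_stubs :
    Summit.FinalStateConjecture.FinalStateConjecture.Theses.LapseTrumpetKID.TrappedWellsSubextremal :=
  TrappedWellsSubextremal_of stub_extremalHoleDigsExteriorWell stub_exteriorWellsReachFarZone

end Summit.FinalStateConjecture.FinalStateConjecture.Cruxes.TrappedWellsSubextremal.Birth

end
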